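import Literature.Probability.RandomPlanarGeometry.SLEGridBounds
import HarnessLib

/-!
# Derivative bounds for `f̂ₜ` on the spatial dyadic grid (Rohde–Schramm Thm. 5.2, step 1)

Trunk T-STOCH. The Borel–Cantelli step of the proof of Rohde–Schramm's **Theorem 5.2** (Hölder
continuity of `f̂ₜ`; *Basic properties of SLE*, Ann. Math. 161 (2005) = arXiv:math/0106036,
Thm. 11, p. 12), read verbatim:

> "Fix `κ ≠ 4` and `t > 0`. … Denote `z_{j,n} = (j + i) 2^{-n}`, `0 ≤ n < ∞`, `-2ⁿ < j < 2ⁿ`.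
> We will first show that there is an `h = h(κ) > 0` such that a.s.
> `|f̂ₜ'(z_{j,n})| ≤ C(ω, t) 2^{n(1-h)}` for all `j, n`. Using Corollary 3.5 with `δ = 2^{-nh}`
> we have `P[|f̂ₜ'(z_{j,n})| ≥ 2^{n(1-h)}] ≤ C(κ, b) (1 + 2^{2n})^b 2^{-n(1-h)λ} ϑ(2^{-nh}, a - λ)`.
> Hence `∑ₙ ∑ⱼ P[|f̂ₜ'(z_{j,n})| ≥ 2^{n(1-h)}] < ∞` provided that `1 + 2b - (1-h)λ < 0` and
> `a - λ ≤ 0`, or that `1 + 2b - λ + ah < 0` and `a - λ ≥ 0`. If `0 < κ ≤ 12`, `b = 1/4 + 1/κ`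
> and `h < (κ-4)²/((κ+4)(κ+12))`, the first condition is satisfied. For `κ > 12`, `b = 4/κ` and
> `h < 1/2 - 4/κ` the second condition is satisfied."

Input: Cor. 3.5, the named fact `RohdeSchramm2005_cor35` (`SLEDerivativeEstimates.lean`; proved
in `RohdeSchrammCor35Proofs.lean`). Output (this file, proved):

* `RohdeSchramm.exists_holderExponent` — the exponent bookkeeping: for `κ > 0`, `κ ≠ 4` there
  are `h ∈ (0, 1)` and an admissible `b ∈ [0, 1 + 4/κ]` with `a(κ, b) ≤ λ(κ, b)` and
  `1 + 2b < (1 - h) λ(κ, b)` (the paper's two cases: for `κ > 12`, `b = 4/κ` gives `a = λ = 2`,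
  so that its second condition is the first one; we take `h` half-way to the printed bound).
* `RohdeSchramm2005_cor35.ae_eventually_boxGrid`, `RohdeSchramm2005_cor35.ae_exists_boxGrid` —
  for such `h, b`, every `t ≤ 1` and every width `R`, almost surely
  `|f̂ₜ'((j + i) 2^{-n})| ≤ C(ω) 2^{(1-h) n}` for all `n ∈ ℕ` and all integers `|j| ≤ R 2ⁿ` (the
  paper's `R = 1`; the extra width only costs the factor `(R + 1)^{2b} (2R + 1)` in the
  Borel–Cantelli sum, replacing the spatial rescaling).

As in `SLEGridBounds.lean` everything is stated for an arbitrary Brownian motion `B` with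
everywhere-continuous paths on a probability space `(Ω, P)` and the driving function `√κ B`; no
measurability is needed (outer measures, `MeasureTheory.ae_eventually_notMem`).

## References

* S. Rohde, O. Schramm, *Basic properties of SLE*, Ann. of Math. 161 (2005), Cor. 3.5, Thm. 5.2
  and its proof (arXiv:math/0106036, Thm. 11, p. 12).
-/

noncomputable section

open Set Filter Topology Complex MeasureTheory ProbabilityTheory
open scoped NNReal ENNReal

namespace Literature.Probability.RandomPlanarGeometry

/-! ### The exponents -/

namespace RohdeSchramm

/-- `a(κ, b) - λ(κ, b) = b (κ b - 4)/2`; in particular `a ≤ λ` iff `κ b ≤ 4` (for `b ≥ 0`).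
[cite: RohdeSchramm2005, eq. (3.6)] -/
theorem expA_sub_expLam (κ b : ℝ) : expA κ b - expLam κ b = b * (κ * b - 4) / 2 := by
  rw [expA, expLam]
  ring

/-- **The Hölder exponent of Thm. 5.2 exists**: for `κ > 0`, `κ ≠ 4` there are `0 < h < 1` and
`b ∈ [0, 1 + 4/κ]` with `a(κ, b) ≤ λ(κ, b)` and `1 + 2b < (1 - h) λ(κ, b)` — for `κ ≤ 12` take
`b = 1/4 + 1/κ` (`λ - 1 - 2b = (κ - 4)²/(16κ) > 0`), for `κ > 12` take `b = 4/κ`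
(`a = λ = 2`, `λ - 1 - 2b = 1 - 8/κ > 0`), and `h = (λ - 1 - 2b)/(2λ)`.
[cite: RohdeSchramm2005, Thm 5.2 (proof, arXiv p. 12)] -/
theorem exists_holderExponent {κ : ℝ} (hκ : 0 < κ) (h4 : κ ≠ 4) :
    ∃ h b : ℝ, 0 < h ∧ h < 1 ∧ 0 ≤ b ∧ b ≤ 1 + 4 / κ ∧ expA κ b ≤ expLam κ b ∧
      1 + 2 * b < (1 - h) * expLam κ b := by
  by_cases h12 : κ ≤ 12
  · -- `b = 1/4 + 1/κ`
    set b : ℝ := (κ + 4) / (4 * κ) with hb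
    have hb0 : 0 ≤ b := by positivity
    have hL : expLam κ b = (κ + 4) * (κ + 12) / (16 * κ) := by
      rw [expLam, hb]
      field_simp
      ring
    have hgap : expLam κ b - 1 - 2 * b = (κ - 4) ^ 2 / (16 * κ) := by
      rw [hL, hb]
      field_simp
      ring
    have hgap0 : 0 < expLam κ b - 1 - 2 * b := by
      rw [hgap]
      have : (κ - 4) ^ 2 ≠ 0 := pow_ne_zero 2 (sub_ne_zero.2 h4)
      positivity
    have hL0 : 0 < expLam κ b := by rw [hL]; positivity
    refine ⟨(expLam κ b - 1 - 2 * b) / (2 * expLam κ b), b, div_pos hgap0 (by positivity), ?_,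
      hb0, ?_, ?_, ?_⟩
    · rw [div_lt_one (by positivity)]
      linarith
    · rw [hb, div_le_iff₀ (by positivity)]
      have h1 : (1 + 4 / κ) * (4 * κ) = 4 * κ + 16 := by
        field_simp
        ring
      rw [h1]
      linarith
    · have h := expA_sub_expLam κ b
      have hkb : κ * b - 4 ≤ 0 := by
        rw [hb]
        have : κ * ((κ + 4) / (4 * κ)) = (κ + 4) / 4 := by field_simp
        rw [this]
        linarith
      nlinarith
    · have h1 : (1 - (expLam κ b - 1 - 2 * b) / (2 * expLam κ b)) * expLam κ b =
          expLam κ b - (expLam κ b - 1 - 2 * b) / 2 := by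
        field_simp
      rw [h1]
      linarith
  · -- `b = 4/κ`, where `a = λ = 2`
    rw [not_le] at h12
    set b : ℝ := 4 / κ with hb
    have hb0 : 0 ≤ b := by positivity
    have hL : expLam κ b = 2 := by
      rw [expLam, hb]
      field_simp
      ring
    have hA : expA κ b = 2 := by
      rw [expA, hb]
      field_simp
      ring
    have hgap : expLam κ b - 1 - 2 * b = 1 - 8 / κ := by rw [hL, hb]; ring
    have h8 : 8 / κ < 1 := by rw [div_lt_one hκ]; linarith
    refine ⟨(1 - 8 / κ) / 4, b, by linarith, by linarith, hb0, ?_, by rw [hA, hL], ?_⟩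
    · rw [hb]
      have : 0 ≤ 4 / κ := by positivity
      linarith [show (4 : ℝ) / κ ≤ 4 / κ from le_rfl]
    · rw [hL, hb]
      nlinarith

/-- `ϑ(δ, s) ≤ 1 + |log δ|` for `s ≤ 0`. [folklore] -/
theorem theta_le_of_nonpos (δ : ℝ) {s : ℝ} (hs : s ≤ 0) : theta δ s ≤ 1 + |Real.log δ| := by
  rcases hs.lt_or_eq with hs | rfl
  · rw [theta_of_neg δ hs]
    linarith [abs_nonneg (Real.log δ)]
  · rw [theta_zero]

end RohdeSchramm

/-! ### Borel–Cantelli on the spatial grid `z_{j,n} = (j + i) 2^{-n}` -/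

variable {Ω : Type*} [MeasurableSpace Ω] {P : Measure Ω}

/-- Width bookkeeping: for `|j| ≤ R 2ⁿ`, `1 + j² ≤ (R + 1)² 4ⁿ`. [folklore] -/
theorem one_add_sq_le_of_abs_le {R n : ℕ} {j : ℤ} (hj : |j| ≤ (R : ℤ) * 2 ^ n) :
    1 + (j : ℝ) ^ 2 ≤ ((R : ℝ) + 1) ^ 2 * (4 : ℝ) ^ n := by
  have h1 : |(j : ℝ)| ≤ (R : ℝ) * 2 ^ n := by
    have : ((|j| : ℤ) : ℝ) ≤ (((R : ℤ) * 2 ^ n : ℤ) : ℝ) := by exact_mod_cast hj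
    push_cast at this
    exact this
  have h2 : (j : ℝ) ^ 2 ≤ ((R : ℝ) * 2 ^ n) ^ 2 := by
    rw [← sq_abs]
    exact pow_le_pow_left₀ (abs_nonneg _) h1 2
  have h4 : (4 : ℝ) ^ n = (2 ^ n) ^ 2 := by
    rw [← pow_mul, mul_comm, pow_mul]
    norm_num
  have h5 : (1 : ℝ) ≤ 4 ^ n := one_le_pow₀ (by norm_num)
  rw [h4] at h5 ⊢
  nlinarith [sq_nonneg ((R : ℝ) * 2 ^ n), sq_nonneg ((2 : ℝ) ^ n)]

/-- Exponent bookkeeping: `((R + 1)² 4ⁿ)^b = (R + 1)^{2b} 2^{2bn}`. [folklore] -/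
theorem width_rpow_eq (R n : ℕ) (b : ℝ) :
    (((R : ℝ) + 1) ^ 2 * (4 : ℝ) ^ n) ^ b = (((R : ℝ) + 1) ^ 2) ^ b * (2 : ℝ) ^ (2 * b * n) := by
  rw [Real.mul_rpow (by positivity) (by positivity)]
  congr 1
  have h4 : (4 : ℝ) ^ n = (2 : ℝ) ^ ((2 * n : ℕ) : ℝ) := by
    rw [Real.rpow_natCast, pow_mul]
    norm_num
  rw [h4, ← Real.rpow_mul two_pos.le]
  congr 1
  push_cast
  ring

/-- **Cor. 3.5 at the grid point `z_{j,n} = (j + i) 2^{-n}`** with `δ = 2^{-nh}` (Rohde–Schramm's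
display after (5.2): `P[|f̂ₜ'(z_{j,n})| ≥ 2^{n(1-h)}] ≤ C(κ,b) (1 + j²)^b 2^{-n(1-h)λ} ϑ(2^{-nh}, a-λ)`),
for `a ≤ λ`, where `ϑ ≤ 1 + nh log 2 ≤ (n + 1)(1 + log 2)`.
[cite: RohdeSchramm2005, Thm 5.2 (proof, arXiv p. 12)] -/
theorem RohdeSchramm2005_cor35.boxGridBound (hc : RohdeSchramm2005_cor35 P) {κ : ℝ≥0}
    (hκ : κ ≠ 0) {h b : ℝ} (hh0 : 0 < h) (hh1 : h < 1) (hb0 : 0 ≤ b)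
    (hb1 : b ≤ 1 + 4 / (κ : ℝ)) (hab : RohdeSchramm.expA κ b ≤ RohdeSchramm.expLam κ b) :
    ∃ C : ℝ, 0 ≤ C ∧ ∀ (B : ℝ≥0 → Ω → ℝ), IsBrownianReal B P → (∀ ω, Continuous (B · ω)) →
      ∀ (t : ℝ≥0), t ≤ 1 → ∀ (n : ℕ) (j : ℤ),
        P {ω | (2 : ℝ) ^ ((1 - h) * n) ≤
            ‖deriv (Loewner.fHat (fun s ↦ Real.sqrt κ * B s ω) t)
              ((((j : ℝ) * (2 : ℝ) ^ (-(n : ℝ)) : ℝ) : ℂ) +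
                I * (((2 : ℝ) ^ (-(n : ℝ)) : ℝ) : ℂ))‖} ≤
          ENNReal.ofReal (C * (1 + (j : ℝ) ^ 2) ^ b * ((n : ℝ) + 1) *
            (2 : ℝ) ^ (-((1 - h) * RohdeSchramm.expLam κ b) * n)) := by
  obtain ⟨C₀, hC₀⟩ := hc κ hκ b hb0 hb1
  set L := RohdeSchramm.expLam κ b with hL
  set A := RohdeSchramm.expA κ b with hA
  refine ⟨max C₀ 0 * (1 + Real.log 2), by positivity, fun B hB hBc t ht n j ↦ ?_⟩
  have hl2 : 0 ≤ Real.log 2 := Real.log_nonneg one_le_two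
  have hn0 : (0 : ℝ) ≤ n := Nat.cast_nonneg n
  -- the parameters `x = j 2^{-n}`, `y = 2^{-n}`, `δ = 2^{-nh}`
  set y : ℝ := (2 : ℝ) ^ (-(n : ℝ)) with hy
  set δ : ℝ := (2 : ℝ) ^ (-(h * n)) with hδ
  set x : ℝ := (j : ℝ) * y with hx
  have hy0 : 0 < y := Real.rpow_pos_of_pos two_pos _
  have hδ0 : 0 < δ := Real.rpow_pos_of_pos two_pos _
  have hy1 : y ≤ 1 := Real.rpow_le_one_of_one_le_of_nonpos one_le_two (by linarith)
  have hhn : 0 ≤ h * n := mul_nonneg hh0.le hn0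
  have hδ1 : δ ≤ 1 := Real.rpow_le_one_of_one_le_of_nonpos one_le_two (by linarith)
  have hdy : δ / y = (2 : ℝ) ^ ((1 - h) * n) := by
    rw [hδ, hy, ← Real.rpow_sub two_pos]
    congr 1
    ring
  have hyd : y / δ = (2 : ℝ) ^ (-((1 - h) * n)) := by
    rw [hδ, hy, ← Real.rpow_sub two_pos]
    congr 1
    ring
  have hxy : x ^ 2 / y ^ 2 = (j : ℝ) ^ 2 := by
    rw [hx, mul_pow, mul_div_assoc, div_self (pow_ne_zero 2 hy0.ne'), mul_one]
  have key := hC₀ B hB hBc t ht x y δ hy0 hy1 hδ0 hδ1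
  rw [hdy, hxy] at key
  refine key.trans (ENNReal.ofReal_le_ofReal ?_)
  -- the arithmetic of the right-hand side
  have hpow : (y / δ) ^ L = (2 : ℝ) ^ (-((1 - h) * L) * n) := by
    rw [hyd, ← Real.rpow_mul two_pos.le]
    congr 1
    ring
  have hlogδ : |Real.log δ| = h * n * Real.log 2 := by
    rw [hδ, Real.log_rpow two_pos]
    have h0 : 0 ≤ h * n * Real.log 2 := mul_nonneg hhn hl2
    rw [abs_of_nonpos (by linarith)]
    ring
  have htheta : RohdeSchramm.theta δ (A - L) ≤ ((n : ℝ) + 1) * (1 + Real.log 2) := by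
    have h1 := RohdeSchramm.theta_le_of_nonpos δ (sub_nonpos.2 hab)
    rw [hlogδ] at h1
    have h2 : h * n * Real.log 2 ≤ n * Real.log 2 := by
      have := mul_le_of_le_one_left (mul_nonneg hn0 hl2) hh1.le
      linarith [mul_assoc h (n : ℝ) (Real.log 2)]
    nlinarith
  have hT : 0 ≤ RohdeSchramm.theta δ (A - L) :=
    zero_le_one.trans (RohdeSchramm.one_le_theta hδ0 hδ1 _)
  have hX : 0 ≤ (1 + (j : ℝ) ^ 2) ^ b := Real.rpow_nonneg (by positivity) _
  have hY : 0 ≤ (y / δ) ^ L := Real.rpow_nonneg (div_pos hy0 hδ0).le _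
  have hC0 : C₀ ≤ max C₀ 0 := le_max_left _ _
  have hm0 : 0 ≤ max C₀ 0 := le_max_right _ _
  calc C₀ * (1 + (j : ℝ) ^ 2) ^ b * (y / δ) ^ L * RohdeSchramm.theta δ (A - L)
      ≤ max C₀ 0 * (1 + (j : ℝ) ^ 2) ^ b * (y / δ) ^ L * RohdeSchramm.theta δ (A - L) := by
        gcongr
    _ ≤ max C₀ 0 * (1 + (j : ℝ) ^ 2) ^ b * (y / δ) ^ L * (((n : ℝ) + 1) * (1 + Real.log 2)) :=
        mul_le_mul_of_nonneg_left htheta (by positivity)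
    _ = max C₀ 0 * (1 + Real.log 2) * (1 + (j : ℝ) ^ 2) ^ b * ((n : ℝ) + 1) *
          (2 : ℝ) ^ (-((1 - h) * L) * n) := by
        rw [hpow]
        ring

/-- **Derivative bounds on the spatial grid, eventually** (Borel–Cantelli): for `κ > 0`, exponents
`h, b` as in `RohdeSchramm.exists_holderExponent`, `t ≤ 1`, a width `R` and a Brownian motion
`B` with continuous paths, almost surely, for all sufficiently large `n` and every integer
`|j| ≤ R 2ⁿ`, `|f̂ₜ'((j + i) 2^{-n})| < 2^{(1-h) n}` ("there is a constant … such that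
`|f̂ₜ'(z_{j,n})| ≤ C(ω,t) 2^{n(1-h)}` for all `j, n`", the Borel–Cantelli sum being
`≤ ∑ₙ (2R+1) 2ⁿ (R+1)^{2b} 2^{2bn} (n+1) 2^{-(1-h)λ n} < ∞` as `1 + 2b < (1-h)λ`).
[cite: RohdeSchramm2005, Thm 5.2 (proof, arXiv p. 12)] -/
theorem RohdeSchramm2005_cor35.ae_eventually_boxGrid (hc : RohdeSchramm2005_cor35 P) {κ : ℝ≥0}
    (hκ : κ ≠ 0) {h b : ℝ} (hh0 : 0 < h) (hh1 : h < 1) (hb0 : 0 ≤ b)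
    (hb1 : b ≤ 1 + 4 / (κ : ℝ)) (hab : RohdeSchramm.expA κ b ≤ RohdeSchramm.expLam κ b)
    (he : 1 + 2 * b < (1 - h) * RohdeSchramm.expLam κ b)
    {B : ℝ≥0 → Ω → ℝ} (hB : IsBrownianReal B P) (hBc : ∀ ω, Continuous (B · ω))
    {t : ℝ≥0} (ht : t ≤ 1) (R : ℕ) :
    ∀ᵐ ω ∂P, ∀ᶠ n : ℕ in atTop, ∀ j : ℤ, |j| ≤ (R : ℤ) * 2 ^ n →
      ‖deriv (Loewner.fHat (fun s ↦ Real.sqrt κ * B s ω) t)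
        ((((j : ℝ) * (2 : ℝ) ^ (-(n : ℝ)) : ℝ) : ℂ) + I * (((2 : ℝ) ^ (-(n : ℝ)) : ℝ) : ℂ))‖ <
        (2 : ℝ) ^ ((1 - h) * n) := by
  obtain ⟨C, hC0, hC⟩ := hc.boxGridBound hκ hh0 hh1 hb0 hb1 hab
  set L := RohdeSchramm.expLam κ b with hL
  set ε : ℝ := (1 - h) * L - 1 - 2 * b with hε
  have hε0 : 0 < ε := by rw [hε]; linarith
  -- the derivative at the grid point
  set D : Ω → ℕ → ℤ → ℝ := fun ω n j ↦
    ‖deriv (Loewner.fHat (fun s ↦ Real.sqrt κ * B s ω) t)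
      ((((j : ℝ) * (2 : ℝ) ^ (-(n : ℝ)) : ℝ) : ℂ) + I * (((2 : ℝ) ^ (-(n : ℝ)) : ℝ) : ℂ))‖ with hD
  -- bad events
  set A : ℕ → Set Ω := fun n ↦ ⋃ j ∈ Finset.Icc (-((R : ℤ) * 2 ^ n)) ((R : ℤ) * 2 ^ n),
    {ω | (2 : ℝ) ^ ((1 - h) * n) ≤ D ω n j} with hA
  set K : ℝ := C * (((R : ℝ) + 1) ^ 2) ^ b with hK
  have hK0 : 0 ≤ K := by positivity
  have hone : ∀ (n : ℕ) (j : ℤ), |j| ≤ (R : ℤ) * 2 ^ n →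
      P {ω | (2 : ℝ) ^ ((1 - h) * n) ≤ D ω n j} ≤
        ENNReal.ofReal (K * ((n : ℝ) + 1) * (2 : ℝ) ^ (-(ε + 1) * n)) := by
    intro n j hj
    refine (hC B hB hBc t ht n j).trans (ENNReal.ofReal_le_ofReal ?_)
    have h1 : (1 + (j : ℝ) ^ 2) ^ b ≤ (((R : ℝ) + 1) ^ 2) ^ b * (2 : ℝ) ^ (2 * b * n) := by
      rw [← width_rpow_eq R n b]
      exact Real.rpow_le_rpow (by positivity) (one_add_sq_le_of_abs_le hj) hb0
    have h2 : (2 : ℝ) ^ (2 * b * n) * (2 : ℝ) ^ (-((1 - h) * L) * n) =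
        (2 : ℝ) ^ (-(ε + 1) * n) := by
      rw [← Real.rpow_add two_pos]
      congr 1
      rw [hε]
      ring
    have h3 : 0 ≤ ((n : ℝ) + 1) * (2 : ℝ) ^ (-((1 - h) * L) * n) :=
      mul_nonneg (by positivity) (Real.rpow_nonneg two_pos.le _)
    calc C * (1 + (j : ℝ) ^ 2) ^ b * ((n : ℝ) + 1) * (2 : ℝ) ^ (-((1 - h) * L) * n)
        = C * (1 + (j : ℝ) ^ 2) ^ b * (((n : ℝ) + 1) * (2 : ℝ) ^ (-((1 - h) * L) * n)) := by
          ring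
      _ ≤ C * ((((R : ℝ) + 1) ^ 2) ^ b * (2 : ℝ) ^ (2 * b * n)) *
            (((n : ℝ) + 1) * (2 : ℝ) ^ (-((1 - h) * L) * n)) :=
          mul_le_mul_of_nonneg_right (mul_le_mul_of_nonneg_left h1 hC0) h3
      _ = K * ((n : ℝ) + 1) * ((2 : ℝ) ^ (2 * b * n) * (2 : ℝ) ^ (-((1 - h) * L) * n)) := by
          rw [hK]
          ring
      _ = K * ((n : ℝ) + 1) * (2 : ℝ) ^ (-(ε + 1) * n) := by rw [h2]
  have hcard : ∀ n : ℕ, ((Finset.Icc (-((R : ℤ) * 2 ^ n)) ((R : ℤ) * 2 ^ n)).card : ℝ) ≤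
      (2 * R + 1) * (2 : ℝ) ^ n := by
    intro n
    rw [Int.card_Icc]
    have h1 : ((R : ℤ) * 2 ^ n + 1 - -((R : ℤ) * 2 ^ n)).toNat = 2 * (R * 2 ^ n) + 1 := by
      have : (R : ℤ) * 2 ^ n + 1 - -((R : ℤ) * 2 ^ n) = ((2 * (R * 2 ^ n) + 1 : ℕ) : ℤ) := by
        push_cast
        ring
      rw [this, Int.toNat_natCast]
    rw [h1]
    push_cast
    have : (1 : ℝ) ≤ 2 ^ n := one_le_pow₀ one_le_two
    nlinarith
  have hbound : ∀ n, P (A n) ≤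
      ENNReal.ofReal ((2 * R + 1) * K * (((n : ℝ) + 1) * (2 : ℝ) ^ (-(ε * n)))) := by
    intro n
    have hexp : (2 : ℝ) ^ n * (2 : ℝ) ^ (-(ε + 1) * n) = (2 : ℝ) ^ (-(ε * n)) := by
      rw [← Real.rpow_natCast, ← Real.rpow_add two_pos]
      congr 1
      ring
    calc P (A n) ≤ ∑ j ∈ Finset.Icc (-((R : ℤ) * 2 ^ n)) ((R : ℤ) * 2 ^ n),
          P {ω | (2 : ℝ) ^ ((1 - h) * n) ≤ D ω n j} := measure_biUnion_finset_le _ _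
      _ ≤ ∑ _j ∈ Finset.Icc (-((R : ℤ) * 2 ^ n)) ((R : ℤ) * 2 ^ n),
          ENNReal.ofReal (K * ((n : ℝ) + 1) * (2 : ℝ) ^ (-(ε + 1) * n)) :=
          Finset.sum_le_sum fun j hj ↦ hone n j (abs_le.2 (Finset.mem_Icc.1 hj))
      _ = ENNReal.ofReal (((Finset.Icc (-((R : ℤ) * 2 ^ n)) ((R : ℤ) * 2 ^ n)).card : ℕ) : ℝ) *
            ENNReal.ofReal (K * ((n : ℝ) + 1) * (2 : ℝ) ^ (-(ε + 1) * n)) := by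
          rw [Finset.sum_const, nsmul_eq_mul, ENNReal.ofReal_natCast]
      _ ≤ ENNReal.ofReal ((2 * R + 1) * (2 : ℝ) ^ n) *
            ENNReal.ofReal (K * ((n : ℝ) + 1) * (2 : ℝ) ^ (-(ε + 1) * n)) :=
          mul_le_mul_left (ENNReal.ofReal_le_ofReal (hcard n)) _
      _ = ENNReal.ofReal ((2 * R + 1) * (2 : ℝ) ^ n *
            (K * ((n : ℝ) + 1) * (2 : ℝ) ^ (-(ε + 1) * n))) :=
          (ENNReal.ofReal_mul (by positivity)).symm
      _ = ENNReal.ofReal ((2 * R + 1) * K * (((n : ℝ) + 1) * (2 : ℝ) ^ (-(ε * n)))) := by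
          rw [← hexp]
          ring_nf
  have hsum : ∑' n, P (A n) ≠ ∞ := by
    refine ne_top_of_le_ne_top ?_ (ENNReal.tsum_le_tsum hbound)
    have hnn : ∀ n : ℕ, 0 ≤ (2 * R + 1) * K * (((n : ℝ) + 1) * (2 : ℝ) ^ (-(ε * n))) :=
      fun n ↦ mul_nonneg (by positivity) (mul_nonneg (by positivity) (Real.rpow_nonneg two_pos.le _))
    rw [← ENNReal.ofReal_tsum_of_nonneg hnn
      ((summable_succ_mul_two_rpow_neg hε0).mul_left ((2 * R + 1) * K))]
    exact ENNReal.ofReal_ne_top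
  filter_upwards [ae_eventually_notMem hsum] with ω hω
  filter_upwards [hω] with n hn j hj
  simp only [hA, Set.mem_iUnion, Finset.mem_Icc, Set.mem_setOf_eq, not_exists, not_le,
    exists_prop, not_and] at hn
  exact hn j (abs_le.1 hj)

/-- **Derivative bounds on the spatial grid with a random constant**: under the hypotheses of
`ae_eventually_boxGrid`, almost surely there is `C = C(ω, t)` with
`|f̂ₜ'((j + i) 2^{-n})| ≤ C 2^{(1-h) n}` for ALL `n ∈ ℕ` and all integers `|j| ≤ R 2ⁿ`
(Rohde–Schramm's display (5.2)). [cite: RohdeSchramm2005, Thm 5.2 (proof, display (5.2))] -/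
theorem RohdeSchramm2005_cor35.ae_exists_boxGrid (hc : RohdeSchramm2005_cor35 P) {κ : ℝ≥0}
    (hκ : κ ≠ 0) {h b : ℝ} (hh0 : 0 < h) (hh1 : h < 1) (hb0 : 0 ≤ b)
    (hb1 : b ≤ 1 + 4 / (κ : ℝ)) (hab : RohdeSchramm.expA κ b ≤ RohdeSchramm.expLam κ b)
    (he : 1 + 2 * b < (1 - h) * RohdeSchramm.expLam κ b)
    {B : ℝ≥0 → Ω → ℝ} (hB : IsBrownianReal B P) (hBc : ∀ ω, Continuous (B · ω))
    {t : ℝ≥0} (ht : t ≤ 1) (R : ℕ) :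
    ∀ᵐ ω ∂P, ∃ C : ℝ, ∀ (n : ℕ) (j : ℤ), |j| ≤ (R : ℤ) * 2 ^ n →
      ‖deriv (Loewner.fHat (fun s ↦ Real.sqrt κ * B s ω) t)
        ((((j : ℝ) * (2 : ℝ) ^ (-(n : ℝ)) : ℝ) : ℂ) + I * (((2 : ℝ) ^ (-(n : ℝ)) : ℝ) : ℂ))‖ ≤
        C * (2 : ℝ) ^ ((1 - h) * n) := by
  filter_upwards [hc.ae_eventually_boxGrid hκ hh0 hh1 hb0 hb1 hab he hB hBc ht R] with ω hω
  obtain ⟨n₀, hn₀⟩ := eventually_atTop.1 hω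
  -- the grid values, as an opaque function `D n j`
  obtain ⟨D, hD⟩ : ∃ D : ℕ → ℤ → ℝ, ∀ (n : ℕ) (j : ℤ), D n j =
      ‖deriv (Loewner.fHat (fun s ↦ Real.sqrt κ * B s ω) t)
        ((((j : ℝ) * (2 : ℝ) ^ (-(n : ℝ)) : ℝ) : ℂ) + I * (((2 : ℝ) ^ (-(n : ℝ)) : ℝ) : ℂ))‖ :=
    ⟨_, fun _ _ ↦ rfl⟩
  have hD0 : ∀ n j, 0 ≤ D n j := fun n j ↦ by rw [hD]; exact norm_nonneg _
  -- a bound for the finitely many grid values with `n < n₀`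
  set S : Finset (Σ _ : ℕ, ℤ) :=
    (Finset.range n₀).sigma fun n ↦ Finset.Icc (-((R : ℤ) * 2 ^ n)) ((R : ℤ) * 2 ^ n) with hS
  obtain ⟨M, hM0, hMle⟩ : ∃ M : ℝ, 0 ≤ M ∧ ∀ (n : ℕ) (j : ℤ), n < n₀ →
      |j| ≤ (R : ℤ) * 2 ^ n → D n j ≤ M := by
    refine ⟨∑ p ∈ S, D p.1 p.2, Finset.sum_nonneg fun p _ ↦ hD0 _ _, fun n j hn hj ↦ ?_⟩
    have hp : (⟨n, j⟩ : Σ _ : ℕ, ℤ) ∈ S := by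
      rw [hS, Finset.mem_sigma]
      exact ⟨Finset.mem_range.2 hn, Finset.mem_Icc.2 (abs_le.1 hj)⟩
    exact Finset.single_le_sum (f := fun p : (Σ _ : ℕ, ℤ) ↦ D p.1 p.2) (fun p _ ↦ hD0 _ _) hp
  have hpow : ∀ n : ℕ, 1 ≤ (2 : ℝ) ^ ((1 - h) * n) := fun n ↦
    Real.one_le_rpow one_le_two (mul_nonneg (by linarith) (Nat.cast_nonneg n))
  refine ⟨max 1 M, fun n j hj ↦ ?_⟩
  rw [← hD]
  rcases lt_or_ge n n₀ with hn | hn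
  · calc D n j ≤ M := hMle n j hn hj
      _ ≤ max 1 M * 1 := by rw [mul_one]; exact le_max_right _ _
      _ ≤ max 1 M * (2 : ℝ) ^ ((1 - h) * n) :=
          mul_le_mul_of_nonneg_left (hpow n) (le_trans zero_le_one (le_max_left _ _))
  · have hnj := hn₀ n hn j hj
    rw [← hD] at hnj
    calc D n j ≤ (2 : ℝ) ^ ((1 - h) * n) := hnj.le
      _ = 1 * (2 : ℝ) ^ ((1 - h) * n) := (one_mul _).symm
      _ ≤ max 1 M * (2 : ℝ) ^ ((1 - h) * n) :=
          mul_le_mul_of_nonneg_right (le_max_left _ _) (Real.rpow_nonneg two_pos.le _)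

end Literature.Probability.RandomPlanarGeometry
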